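import Summits.QuantumFields.Balaban3D.Proofs.RestrictedResiduals

/-!
# Bałaban CMP 102 (1985), d = 3 lane — `Proofs.RestrictedResidualsStd` (2/3): THE RESTRICTED READINGS OF (41)/(47) FOR THE LANE'S
# CONSTRUCTED TOWER, BY INDUCTION ALONG THE TRIVIAL HISTORY — the spine's `Ineq41RestrictedAE W ε₁ k` / `Ineq47RestrictedAE W ε₁ k`
# INHABITED modulo the trivial-history inputs `RestrictedResiduals.TrivStepInputs` of every step `j < K`, and the two-sided K1-S sandwich
# on the whole small-field domain WITHOUT a threshold-inclusion hypothesis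

Source: T. Bałaban, *Ultraviolet stability of three-dimensional lattice pure gauge field theories*, Commun. Math. Phys. **102** (1985)
255–275 [Balaban1985UV3] ([B10]; PDF page = journal page − 254).  (41) p. 266, (47) p. 267 L17–20, and p. 272 L32–33 «The lower bound is
proved in the same way, with all simplifications coming from the fact that Ω_{k+1} = T_η.»  Cell `ym3-torus` (HUMAN RULING D-0037, YM
ladder rung R3), seat p1 gen 3, task P1-7 of the cell's TARGET.md §4: «a typed reduction `RunAlpha … → Ineq41Restricted W δ k` turns node
N6a's GAP-STATED into IN-TREE-MODULO-(α)».

WHAT THIS FILE PROVES (`W := (stdTowerInput X K 𝔖).towerWith slot`, `ε₁(k) = g_kp(g_k)`):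
* `step0_std` — (41)₀ ∧ (47)₀ for the constructed tower (seat p4's `Step0Tower.step0_towerObjects`, hypotheses by construction);
  `hint41_std` — integrability of the trivial-history (41)_k integrand (as `Bound55Std.hint47_std`).
* `restricted47_chi_zero` / `restricted47_chi_succ` / `restricted47_chi_ae` — `χ_k·exp[(47)_k exponent at triv] ≤ ρ^res_k` dV-a.e. for
  `k ≤ K`, with `χ_k` THE FIELD FUNCTION OF (4) at `ε₁(k)` (the label of R3D-02, lead ruling R-CHI (ii)): step = a.e. monotonicity of the
  RN transport (spine `rt_mono_ae`) + RESIDUAL R3D-02 `Fibre57Low` + `ρ^res_{k+1} = χ_{k+1}·T_kρ^res_k` + `χ² = χ` + §1 bookkeeping.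
* `restricted41_zero` / `restricted41_succ` / `restricted41_ae` — `ρ^res_k ≤ χ_k·exp[(41)_k exponent at triv]` dV-a.e.: step = monotonicity
  + RESIDUAL R3D-01 `Fibre49` AT `h′ = triv` (step weight = old mass = 1, `χB(triv) = χ_k` by `FibreClash.chiB_triv_eq`, `T_k1 = 1` a.e.).
* `ineq47RestrictedAE_std`, `ineq41RestrictedAE_std` — THE SPINE'S RESTRICTED READINGS BY NAME; `sandwich_ae_std` — for dV-a.e. `ε₁(k)`-small
  `V`, `e^{−E_k−Rm_k}e^{F(V)} ≤ ρ^res_k(V) ≤ e^{−E_k+Rm_k}e^{F(V)}` with NO inclusion «small field ⇒ (47)-small minimizer» (the cell's latent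
  row G3D-09 / node N5thr sits inside R3D-02's label, not beside it; contrast the spine's `sandwich_ae_of_inclusion`).
HONEST FRAMING (lane PLAN.md §0): UV stability of the d = 3 lattice theory on a finite torus, as printed, MODULO its printed inputs — NOT a
continuum limit, NOT a mass gap, NOT d = 4, nothing about the Millennium problem; the residuals, leaves and (α) rows are hypotheses; nothing
of the paper is asserted.  No `sorry`, no new axiom.
-/

noncomputable section

namespace Summit.QuantumFields.Balaban3D.Proofs.RestrictedResidualsStd


open _root_.MeasureTheory
open Literature.MathematicalPhysics.QuantumFieldTheory.Balaban1983to89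
open Literature.MathematicalPhysics.QuantumFieldTheory.Balaban1983to89.AveragingRT (rnTransport rnTransport_nonneg)
open Literature.MathematicalPhysics.QuantumFieldTheory.Balaban1983to89.B10SectAGathering
open Literature.MathematicalPhysics.QuantumFieldTheory.Balaban1985CMP102
open Literature.MathematicalPhysics.QuantumFieldTheory.Balaban1985CMP102.Setting
open Literature.MathematicalPhysics.QuantumFieldTheory.Balaban1985CMP102.SectB.TowerObjects (chiAll rt_mono_ae)
open Summit.QuantumFields.Balaban3D.Carriers
open Summit.QuantumFields.Balaban3D.Proofs.Bound55Masses
open Summit.QuantumFields.Balaban3D.Proofs.Bound55Std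

open Summit.QuantumFields.Balaban3D.Proofs.RestrictedResiduals
variable {L : ℕ}

section Std

variable {S : Scales L} {G : Type} [GaugeGroup G] [MeasurableSpace G] [HaarData G] [RegularGaugeGroup G]
  {V : Type} [NormedAddCommGroup V] [NormedSpace ℂ V]
  (X : ExternalInputs S G) (K : CarrierConsts) (𝔖 : ∀ k, StepSeries S G V (nblkOf S K k) k) (slot : ℕ → Prop)

omit [RegularGaugeGroup G] in
/-- **(41)₀ ∧ (47)₀ for the constructed tower** — (1) p. 256 at `k = 0` (seat p4's `Step0Tower.step0_towerObjects`; its three hypotheses hold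
by construction: one history with `LF 0 V F = exp (F triv)` (p1 `lf_zero`), `U₀ = id` (`ukAll`), `Pint 0 ≡ 0` (the series' `Pint`)).
[cite: Balaban1985UV3, (1) p.256] -/
theorem step0_std : B10.Step0Printed ((stdTowerInput X K 𝔖).towerWith slot).toTowerRun :=
  Step0Tower.step0_towerObjects ((stdTowerInput X K 𝔖).towerWith slot) (fun V F => lf_zero (stdTowerInput X K 𝔖).W V F)
    (fun V => by
      show (run3 ((stdTowerInput X K 𝔖).toRunInput slot)).Uk 0 V = V
      rw [TowerInput.ukAll_eq]; rfl)
    (fun _ _ => rfl)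

/-- **`hint41` DERIVED**: the trivial-history (41)_k integrand `χ_k·exp[−(1/g_k²)A^η(U_k) + Σ𝒫(triv) − E_k + remainders]` is integrable on `dU_k`
(as `Bound55Std.hint47_std`, opposite sign of the remainder: `A^η ≥ 0`, `Σ𝒫(triv)` measurable and bounded above, `χ_k ∈ [0,1]` measurable).
[folklore] -/
theorem hint41_std (k : ℕ) (hU : Measurable ((stdTowerInput X K 𝔖).UkH k (Hist.triv S.P k)))
    (hPm : Measurable ((stdTowerInput X K 𝔖).Pint k (Hist.triv S.P k))) (cP : ℝ)
    (hPb : ∀ U : GaugeField S.P k G, (stdTowerInput X K 𝔖).Pint k (Hist.triv S.P k) U ≤ cP) :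
    Integrable (fun U => ((stdTowerInput X K 𝔖).towerWith slot).chi k U *
      Real.exp (-(((stdTowerInput X K 𝔖).towerWith slot).mainT k (Hist.triv S.P k) U)
        + (stdTowerInput X K 𝔖).Pint k (Hist.triv S.P k) U
        - ((stdTowerInput X K 𝔖).towerWith slot).Ecst k + ((stdTowerInput X K 𝔖).towerWith slot).Rm k)) (fieldMeasure S.P k G) := by
  have hmain : ∀ U, ((stdTowerInput X K 𝔖).towerWith slot).mainT k (Hist.triv S.P k) U
      = (S.gk k)⁻¹ ^ 2 * S.actionEta k ((stdTowerInput X K 𝔖).UkH k (Hist.triv S.P k) U) := fun _ => rfl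
  refine Transport48.integrable_weight_mul_exp (SectB.TowerObjects.measurable_chiAll k (eps1Of S K k))
    (chi_nonneg' X K 𝔖 slot k) (chi_le_one' X K 𝔖 slot k) ?_
    (c := cP - ((stdTowerInput X K 𝔖).towerWith slot).Ecst k + ((stdTowerInput X K 𝔖).towerWith slot).Rm k) ?_
  · simp_rw [hmain]
    exact (((measurable_const.mul ((measurable_actionEta (S := S) k).comp hU)).neg.add hPm).sub measurable_const).add
      measurable_const
  · intro U
    have h0 : 0 ≤ ((stdTowerInput X K 𝔖).towerWith slot).mainT k (Hist.triv S.P k) U := by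
      rw [hmain]; exact mul_nonneg (sq_nonneg _) (actionEta_nonneg (S := S) k _)
    have h1 := hPb U
    linarith

omit [RegularGaugeGroup G] in
/-- **BASE OF THE LOWER INDUCTION**: `χ₀·exp[(47)₀ exponent] ≤ ρ^res_0 = χ₀·ρ₀` pointwise, from (47)₀ (`step0_std`) and `χ₀·χ₀ = χ₀`.
[cite: Balaban1985UV3, (1) p.256 + (47) p.267] -/
theorem restricted47_chi_zero :
    ∀ᵐ U ∂(fieldMeasure S.P 0 G), ((stdTowerInput X K 𝔖).towerWith slot).chi 0 U *
        Real.exp (-(((stdTowerInput X K 𝔖).towerWith slot).mainT 0 (Hist.triv S.P 0) U)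
          + (stdTowerInput X K 𝔖).Pint 0 (Hist.triv S.P 0) U
          - ((stdTowerInput X K 𝔖).towerWith slot).Ecst 0 - ((stdTowerInput X K 𝔖).towerWith slot).Rm 0)
      ≤ ((stdTowerInput X K 𝔖).towerWith slot).rhoRes (eps1Of S K) 0 U := by
  refine ae_of_all _ fun U => ?_
  have h47 : ((stdTowerInput X K 𝔖).towerWith slot).chi 0 U *
        Real.exp (-(((stdTowerInput X K 𝔖).towerWith slot).mainT 0 (Hist.triv S.P 0) U)
          + (stdTowerInput X K 𝔖).Pint 0 (Hist.triv S.P 0) U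
          - ((stdTowerInput X K 𝔖).towerWith slot).Ecst 0 - ((stdTowerInput X K 𝔖).towerWith slot).Rm 0)
      ≤ ((stdTowerInput X K 𝔖).towerWith slot).rho0 U := (step0_std X K 𝔖 slot).2 U
  have key := mul_le_mul_of_nonneg_left h47 (chi_nonneg' X K 𝔖 slot 0 U)
  rw [← mul_assoc, chi_mul_self] at key
  exact key

omit [RegularGaugeGroup G] in
/-- **BASE OF THE UPPER INDUCTION**: `ρ^res_0 = χ₀·ρ₀ ≤ χ₀·exp[(41)₀ exponent at triv]` pointwise, from (41)₀ (`step0_std`), the one-history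
functional `LF 0 V F = exp (F triv)` and `Z₀(triv) = 0`. [cite: Balaban1985UV3, (1) p.256 + (41) p.266] -/
theorem restricted41_zero :
    ∀ᵐ U ∂(fieldMeasure S.P 0 G), ((stdTowerInput X K 𝔖).towerWith slot).rhoRes (eps1Of S K) 0 U
      ≤ ((stdTowerInput X K 𝔖).towerWith slot).chi 0 U *
        Real.exp (-(((stdTowerInput X K 𝔖).towerWith slot).mainT 0 (Hist.triv S.P 0) U)
          + (stdTowerInput X K 𝔖).Pint 0 (Hist.triv S.P 0) U
          - ((stdTowerInput X K 𝔖).towerWith slot).Ecst 0 + ((stdTowerInput X K 𝔖).towerWith slot).Rm 0) := by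
  refine ae_of_all _ fun U => ?_
  have hU0 : ∀ V : GaugeField S.P 0 G, ((stdTowerInput X K 𝔖).towerWith slot).Uk 0 V = V := fun V => by
    show (run3 ((stdTowerInput X K 𝔖).toRunInput slot)).Uk 0 V = V
    rw [TowerInput.ukAll_eq]; rfl
  have hρ := Step0Tower.rho_zero_towerObjects ((stdTowerInput X K 𝔖).towerWith slot) hU0 U
  rw [← ((stdTowerInput X K 𝔖).towerWith slot).toTowerRun.mainT_triv 0 U] at hρ
  have hρ' : ((stdTowerInput X K 𝔖).towerWith slot).rho0 U
      = Real.exp (-(((stdTowerInput X K 𝔖).towerWith slot).mainT 0 (Hist.triv S.P 0) U)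
          - ((stdTowerInput X K 𝔖).towerWith slot).Ecst 0) := hρ
  have hRm : ((stdTowerInput X K 𝔖).towerWith slot).Rm 0 = 0 := by
    unfold SectB.TowerObjects.Rm
    rw [Finset.range_zero, Finset.sum_empty]
  have hP : (stdTowerInput X K 𝔖).Pint 0 (Hist.triv S.P 0) U = 0 := rfl
  have hres : ((stdTowerInput X K 𝔖).towerWith slot).rhoRes (eps1Of S K) 0 U
      = ((stdTowerInput X K 𝔖).towerWith slot).chi 0 U * ((stdTowerInput X K 𝔖).towerWith slot).rho0 U := rfl
  rw [hres, hP, hRm, add_zero, add_zero, hρ']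

/-- **THE LOWER INDUCTION STEP** `k → k+1` (p. 272 L32–33 «The lower bound is proved in the same way, with all simplifications coming from the fact
that Ω_{k+1} = T_η», in the lane's reading R-RN): from `χ_k·exp[(47)_k at triv] ≤ ρ^res_k` dU-a.e., the a.e. monotonicity of the Radon–Nikodym
transport (`SectBRestrictedLaw.rt_mono_ae`), the RESIDUAL R3D-02 `Fibre57Low` (`χ_{k+1}·exp[(57)] ≤ T_k[χ_k·exp((47)_k)]` a.e.), `ρ^res_{k+1} =
χ_{k+1}·T_kρ^res_k` with `T_k = ` the RN transport a.e., `χ_{k+1}² = χ_{k+1}`, and the exponent bookkeeping `expo47_succ_le_expo57`: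
`χ_{k+1}·exp[(47)_{k+1} at triv] ≤ ρ^res_{k+1}` dV-a.e. [cite: Balaban1985UV3, (47) p.267 + (57) p.270 + p.272 L32–33] -/
theorem restricted47_chi_succ (k : ℕ) (hk : k + 1 ≤ S.K) (I : TrivStepInputs X K 𝔖 slot k)
    (ih : ∀ᵐ U ∂(fieldMeasure S.P k G), ((stdTowerInput X K 𝔖).towerWith slot).chi k U *
        Real.exp (-(((stdTowerInput X K 𝔖).towerWith slot).mainT k (Hist.triv S.P k) U)
          + (stdTowerInput X K 𝔖).Pint k (Hist.triv S.P k) U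
          - ((stdTowerInput X K 𝔖).towerWith slot).Ecst k - ((stdTowerInput X K 𝔖).towerWith slot).Rm k)
      ≤ ((stdTowerInput X K 𝔖).towerWith slot).rhoRes (eps1Of S K) k U) :
    ∀ᵐ V ∂(fieldMeasure S.P (k + 1) G), ((stdTowerInput X K 𝔖).towerWith slot).chi (k + 1) V *
        Real.exp (-(((stdTowerInput X K 𝔖).towerWith slot).mainT (k + 1) (Hist.triv S.P (k + 1)) V)
          + (stdTowerInput X K 𝔖).Pint (k + 1) (Hist.triv S.P (k + 1)) V
          - ((stdTowerInput X K 𝔖).towerWith slot).Ecst (k + 1) - ((stdTowerInput X K 𝔖).towerWith slot).Rm (k + 1))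
      ≤ ((stdTowerInput X K 𝔖).towerWith slot).rhoRes (eps1Of S K) (k + 1) V := by
  have hint47 := hint47_std X K 𝔖 slot k I.hU I.hPm I.cP I.hPb
  have hres := integrable_rhoRes_std X K 𝔖 slot (eps1Of S K) k
  -- a.e. monotonicity of the RN transport over `Ū_k`
  have hmono : rnTransport (X.av k).avg (fun U => ((stdTowerInput X K 𝔖).towerWith slot).chi k U *
        Real.exp (-(((stdTowerInput X K 𝔖).towerWith slot).mainT k (Hist.triv S.P k) U)
          + (stdTowerInput X K 𝔖).Pint k (Hist.triv S.P k) U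
          - ((stdTowerInput X K 𝔖).towerWith slot).Ecst k - ((stdTowerInput X K 𝔖).towerWith slot).Rm k))
      ≤ᵐ[fieldMeasure S.P (k + 1) G] rnTransport (X.av k).avg (((stdTowerInput X K 𝔖).towerWith slot).rhoRes (eps1Of S K) k) :=
    rt_mono_ae (rtOpIOfAC (X.av k) (X.avgAC k)) (X.av_meas k) hint47 hres (integrable_rnTransport _ _ hint47)
      (integrable_rnTransport _ _ hres) ih
  have hT := towerT_ae_eq_rn X K 𝔖 slot k (((stdTowerInput X K 𝔖).towerWith slot).rhoRes (eps1Of S K) k)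
  have h57 : _ ≤ᵐ[fieldMeasure S.P (k + 1) G] _ := I.fibre57Low
  -- the exponent bookkeeping at the trivial history
  have hRm : RmSucc I.P (I.C₁' + I.C₂ + I.C₃ + I.C₄) :=
    I.rmSucc.mono (by have := le_max_right I.C₁ I.C₁'; linarith)
  have hexp : ∀ V : GaugeField S.P (k + 1) G,
      -(((stdTowerInput X K 𝔖).towerWith slot).mainT (k + 1) (Hist.triv S.P (k + 1)) V)
          + (stdTowerInput X K 𝔖).Pint (k + 1) (Hist.triv S.P (k + 1)) V
          - ((stdTowerInput X K 𝔖).towerWith slot).Ecst (k + 1) - ((stdTowerInput X K 𝔖).towerWith slot).Rm (k + 1)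
        ≤ -(((stdTowerInput X K 𝔖).towerWith slot).mainT (k + 1) (Hist.triv S.P (k + 1)) V)
          - ((stdTowerInput X K 𝔖).towerWith slot).Ecst k
          + (I.P.logσ₀ + I.P.dg * Real.log (S.gk k)) * I.P.starB (Hist.triv S.P (k + 1)) + I.P.logZU (Hist.triv S.P (k + 1)) V
          + I.P.Pold (Hist.triv S.P (k + 1)) V - ((stdTowerInput X K 𝔖).towerWith slot).Rm k + I.P.logFl (Hist.triv S.P (k + 1)) V :=
    fun V => expo47_succ_le_expo57 (T := ((stdTowerInput X K 𝔖).towerWith slot).toTowerRun) I.P hk I.cumulantLower I.repr33_60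
      I.vacuumWhole I.decomp35_61 I.norm35 I.starCount I.oldOutside I.pintSucc I.estep62 hRm V
  filter_upwards [hmono, hT, h57] with V h1 h2 h3
  have hres_succ : ((stdTowerInput X K 𝔖).towerWith slot).rhoRes (eps1Of S K) (k + 1) V
      = ((stdTowerInput X K 𝔖).towerWith slot).chi (k + 1) V *
        (((stdTowerInput X K 𝔖).towerWith slot).T k).T (((stdTowerInput X K 𝔖).towerWith slot).rhoRes (eps1Of S K) k) V := rfl
  have hχ := chi_nonneg' X K 𝔖 slot (k + 1) V
  rw [hres_succ, h2]
  calc _ ≤ ((stdTowerInput X K 𝔖).towerWith slot).chi (k + 1) V * Real.exp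
          (-(((stdTowerInput X K 𝔖).towerWith slot).mainT (k + 1) (Hist.triv S.P (k + 1)) V)
          - ((stdTowerInput X K 𝔖).towerWith slot).Ecst k
          + (I.P.logσ₀ + I.P.dg * Real.log (S.gk k)) * I.P.starB (Hist.triv S.P (k + 1)) + I.P.logZU (Hist.triv S.P (k + 1)) V
          + I.P.Pold (Hist.triv S.P (k + 1)) V - ((stdTowerInput X K 𝔖).towerWith slot).Rm k + I.P.logFl (Hist.triv S.P (k + 1)) V) :=
        mul_le_mul_of_nonneg_left (Real.exp_le_exp.mpr (hexp V)) hχ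
    _ = ((stdTowerInput X K 𝔖).towerWith slot).chi (k + 1) V * (((stdTowerInput X K 𝔖).towerWith slot).chi (k + 1) V * Real.exp
          (-(((stdTowerInput X K 𝔖).towerWith slot).mainT (k + 1) (Hist.triv S.P (k + 1)) V)
          - ((stdTowerInput X K 𝔖).towerWith slot).Ecst k
          + (I.P.logσ₀ + I.P.dg * Real.log (S.gk k)) * I.P.starB (Hist.triv S.P (k + 1)) + I.P.logZU (Hist.triv S.P (k + 1)) V
          + I.P.Pold (Hist.triv S.P (k + 1)) V - ((stdTowerInput X K 𝔖).towerWith slot).Rm k + I.P.logFl (Hist.triv S.P (k + 1)) V)) := by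
        rw [← mul_assoc, chi_mul_self]
    _ ≤ _ := mul_le_mul_of_nonneg_left h3 hχ
    _ ≤ _ := mul_le_mul_of_nonneg_left h1 hχ

/-- **THE UPPER INDUCTION STEP** `k → k+1` (p. 271 L13–17 read at the trivial new history, in the lane's reading R-RN): from `ρ^res_k ≤
χ_k·exp[(41)_k at triv]` dU-a.e., the a.e. monotonicity of the RN transport, the RESIDUAL R3D-01 `Fibre49` AT `h′ = triv` (where the step weight
and the old mass are `1` — `stepWeight_triv`, `massRec_triv` —, the small-field factor `χB` of (49) IS `χ_k` — `FibreClash.chiB_triv_eq` —, and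
`T_k 1 = 1` a.e. by Haar compatibility), `ρ^res_{k+1} = χ_{k+1}·T_kρ^res_k`, and the bookkeeping `expo55_triv_le_expo41_succ`:
`ρ^res_{k+1} ≤ χ_{k+1}·exp[(41)_{k+1} at triv]` dV-a.e. [cite: Balaban1985UV3, (41) p.266 + (49)–(58) pp.268–270 + p.271 L13–17] -/
theorem restricted41_succ (k : ℕ) (hk : k + 1 ≤ S.K) (I : TrivStepInputs X K 𝔖 slot k)
    (ih : ∀ᵐ U ∂(fieldMeasure S.P k G), ((stdTowerInput X K 𝔖).towerWith slot).rhoRes (eps1Of S K) k U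
      ≤ ((stdTowerInput X K 𝔖).towerWith slot).chi k U *
        Real.exp (-(((stdTowerInput X K 𝔖).towerWith slot).mainT k (Hist.triv S.P k) U)
          + (stdTowerInput X K 𝔖).Pint k (Hist.triv S.P k) U
          - ((stdTowerInput X K 𝔖).towerWith slot).Ecst k + ((stdTowerInput X K 𝔖).towerWith slot).Rm k)) :
    ∀ᵐ V ∂(fieldMeasure S.P (k + 1) G), ((stdTowerInput X K 𝔖).towerWith slot).rhoRes (eps1Of S K) (k + 1) V
      ≤ ((stdTowerInput X K 𝔖).towerWith slot).chi (k + 1) V *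
        Real.exp (-(((stdTowerInput X K 𝔖).towerWith slot).mainT (k + 1) (Hist.triv S.P (k + 1)) V)
          + (stdTowerInput X K 𝔖).Pint (k + 1) (Hist.triv S.P (k + 1)) V
          - ((stdTowerInput X K 𝔖).towerWith slot).Ecst (k + 1) + ((stdTowerInput X K 𝔖).towerWith slot).Rm (k + 1)) := by
  have hkm : k ≤ S.P.m + S.P.K := by show k ≤ S.m + S.K; omega
  have hint41 := hint41_std X K 𝔖 slot k I.hU I.hPm I.cP I.hPb
  have hres := integrable_rhoRes_std X K 𝔖 slot (eps1Of S K) k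
  have hmono : rnTransport (X.av k).avg (((stdTowerInput X K 𝔖).towerWith slot).rhoRes (eps1Of S K) k)
      ≤ᵐ[fieldMeasure S.P (k + 1) G] rnTransport (X.av k).avg (fun U => ((stdTowerInput X K 𝔖).towerWith slot).chi k U *
        Real.exp (-(((stdTowerInput X K 𝔖).towerWith slot).mainT k (Hist.triv S.P k) U)
          + (stdTowerInput X K 𝔖).Pint k (Hist.triv S.P k) U
          - ((stdTowerInput X K 𝔖).towerWith slot).Ecst k + ((stdTowerInput X K 𝔖).towerWith slot).Rm k)) :=
    rt_mono_ae (rtOpIOfAC (X.av k) (X.avgAC k)) (X.av_meas k) hres hint41 (integrable_rnTransport _ _ hres)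
      (integrable_rnTransport _ _ hint41) ih
  have hT := towerT_ae_eq_rn X K 𝔖 slot k (((stdTowerInput X K 𝔖).towerWith slot).rhoRes (eps1Of S K) k)
  -- R3D-01 at the trivial new history, simplified: step weight = old mass = 1, `χB(triv) = χ_k`, `Z_k(triv) = 0`
  have h49 : _ ≤ᵐ[fieldMeasure S.P (k + 1) G] _ := I.fibre49_triv
  have hL : (fun U => stepWeight K.M₁ (rcolOf S K) (eps1Of S K) (epsSOf S K) k (Hist.triv S.P (k + 1)) U *
        chiB K.M₁ (rcolOf S K) (eps1Of S K) k (Hist.triv S.P (k + 1)) U *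
        ((stdTowerInput X K 𝔖).W.mass k (Hist.triv S.P (k + 1)).proj U *
          Real.exp (-(((stdTowerInput X K 𝔖).towerWith slot).mainT k (Hist.triv S.P (k + 1)).proj U)
            + (stdTowerInput X K 𝔖).Pint k (Hist.triv S.P (k + 1)).proj U
            - ((stdTowerInput X K 𝔖).towerWith slot).Ecst k
            + ((stdTowerInput X K 𝔖).towerWith slot).Zterm k (Hist.triv S.P (k + 1)).proj
            + ((stdTowerInput X K 𝔖).towerWith slot).Rm k)))
      = fun U => ((stdTowerInput X K 𝔖).towerWith slot).chi k U *
        Real.exp (-(((stdTowerInput X K 𝔖).towerWith slot).mainT k (Hist.triv S.P k) U)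
          + (stdTowerInput X K 𝔖).Pint k (Hist.triv S.P k) U
          - ((stdTowerInput X K 𝔖).towerWith slot).Ecst k + ((stdTowerInput X K 𝔖).towerWith slot).Rm k) := by
    funext U
    have hZ : ((stdTowerInput X K 𝔖).towerWith slot).Zterm k (Hist.triv S.P k) = 0 :=
      ((stdTowerInput X K 𝔖).towerWith slot).toTowerRun.Zterm_triv k
    rw [stepWeight_triv K.M₁ (rcolOf S K) (eps1Of S K) (epsSOf S K) hkm U, one_mul, FibreClash.chiB_triv_eq,
      ← FibreClash.chi_eq X K 𝔖 slot k U]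
    simp only [Hist.proj_triv]
    rw [stdTowerInput_mass_triv X K 𝔖 k U, one_mul, hZ, add_zero]
  have hR : (fun U => stepWeight K.M₁ (rcolOf S K) (eps1Of S K) (epsSOf S K) k (Hist.triv S.P (k + 1)) U *
        (stdTowerInput X K 𝔖).W.mass k (Hist.triv S.P (k + 1)).proj U) = fun _ => (1 : ℝ) := by
    funext U
    rw [stepWeight_triv K.M₁ (rcolOf S K) (eps1Of S K) (epsSOf S K) hkm U, one_mul]
    simp only [Hist.proj_triv]
    exact stdTowerInput_mass_triv X K 𝔖 k U
  rw [hL, hR] at h49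
  have hone : rnTransport (X.av k).avg (fun _ => (1 : ℝ)) =ᵐ[fieldMeasure S.P (k + 1) G] fun _ => (1 : ℝ) :=
    RTAlgebra.IsRT.ae_eq (isRT_rnTransport_of_ac (X.avgAC k) _ (integrable_const _))
      (Transport48.isRT_one_of_map (X.av_meas k) (X.av_map k)) (X.av_meas k)
      (integrable_const _) (integrable_rnTransport (X.av k).avg _ (integrable_const _)) (integrable_const _)
  -- the exponent bookkeeping at the trivial history
  have hRm : RmSucc I.P (I.C₁ + I.C₂ + I.C₃ + I.C₄) :=
    I.rmSucc.mono (by have := le_max_left I.C₁ I.C₁'; linarith)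
  have hexp : ∀ V : GaugeField S.P (k + 1) G,
      -(((stdTowerInput X K 𝔖).towerWith slot).mainT (k + 1) (Hist.triv S.P (k + 1)) V)
          - ((stdTowerInput X K 𝔖).towerWith slot).Ecst k
          + (I.P.logσ₀ + I.P.dg * Real.log (S.gk k)) * I.P.starB (Hist.triv S.P (k + 1)) + I.P.logZU (Hist.triv S.P (k + 1)) V
          + I.P.Pold (Hist.triv S.P (k + 1)) V
          + ((stdTowerInput X K 𝔖).towerWith slot).Zterm k (I.P.proj (Hist.triv S.P (k + 1)))
          + ((stdTowerInput X K 𝔖).towerWith slot).Rm k + I.P.logFl (Hist.triv S.P (k + 1)) V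
        ≤ -(((stdTowerInput X K 𝔖).towerWith slot).mainT (k + 1) (Hist.triv S.P (k + 1)) V)
          + (stdTowerInput X K 𝔖).Pint (k + 1) (Hist.triv S.P (k + 1)) V
          - ((stdTowerInput X K 𝔖).towerWith slot).Ecst (k + 1) + ((stdTowerInput X K 𝔖).towerWith slot).Rm (k + 1) :=
    fun V => expo55_triv_le_expo41_succ (T := ((stdTowerInput X K 𝔖).towerWith slot).toTowerRun) I.P hk I.cumulant58 I.repr33_60
      I.vacuumWhole I.decomp35_61 I.norm35 I.starCount I.oldOutside I.pintSucc I.estep62 hRm V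
  filter_upwards [hmono, hT, h49, hone] with V h1 h2 h3 h4
  have hres_succ : ((stdTowerInput X K 𝔖).towerWith slot).rhoRes (eps1Of S K) (k + 1) V
      = ((stdTowerInput X K 𝔖).towerWith slot).chi (k + 1) V *
        (((stdTowerInput X K 𝔖).towerWith slot).T k).T (((stdTowerInput X K 𝔖).towerWith slot).rhoRes (eps1Of S K) k) V := rfl
  have hχ := chi_nonneg' X K 𝔖 slot (k + 1) V
  rw [h4, one_mul] at h3
  rw [hres_succ, h2]
  calc _ ≤ _ := mul_le_mul_of_nonneg_left h1 hχ
    _ ≤ _ := mul_le_mul_of_nonneg_left h3 hχ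
    _ ≤ _ := mul_le_mul_of_nonneg_left (Real.exp_le_exp.mpr (hexp V)) hχ

/-- **THE RESTRICTED LOWER BOUND IN THE χ-OF-(4) FORM, every `k ≤ K`**: given the trivial-history inputs of every step `j < K`,
`χ_k(V)·exp[−(1/g_k²)A^η(U_k(V)) + Σ𝒫(triv) − E_k − Rm_k] ≤ ρ^res_k(V)` dV-a.e., `χ_k` = the FIELD small-field function of (4) at `ε₁(k) = g_kp(g_k)`
(the label under which the lane books R3D-02; print's (47) carries the minimizer's `χ_k` — equal modulo the latent rows G3D-09). Induction
`restricted47_chi_zero` / `restricted47_chi_succ`. [cite: Balaban1985UV3, (47) p.267 + p.272 L32–33] -/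
theorem restricted47_chi_ae (D : ∀ j, j + 1 ≤ S.K → TrivStepInputs X K 𝔖 slot j) :
    ∀ k, k ≤ S.K → ∀ᵐ V ∂(fieldMeasure S.P k G), ((stdTowerInput X K 𝔖).towerWith slot).chi k V *
        Real.exp (-(((stdTowerInput X K 𝔖).towerWith slot).mainT k (Hist.triv S.P k) V)
          + (stdTowerInput X K 𝔖).Pint k (Hist.triv S.P k) V
          - ((stdTowerInput X K 𝔖).towerWith slot).Ecst k - ((stdTowerInput X K 𝔖).towerWith slot).Rm k)
      ≤ ((stdTowerInput X K 𝔖).towerWith slot).rhoRes (eps1Of S K) k V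
  | 0, _ => restricted47_chi_zero X K 𝔖 slot
  | k + 1, hk => restricted47_chi_succ X K 𝔖 slot k hk (D k hk) (restricted47_chi_ae D k (by omega))

/-- **THE RESTRICTED UPPER BOUND, every `k ≤ K`**: `ρ^res_k(V) ≤ χ_k(V)·exp[−(1/g_k²)A^η(U_k(V)) + Σ𝒫(triv) − E_k + Rm_k]` dV-a.e.  Induction
`restricted41_zero` / `restricted41_succ`. [cite: Balaban1985UV3, (41) p.266] -/
theorem restricted41_ae (D : ∀ j, j + 1 ≤ S.K → TrivStepInputs X K 𝔖 slot j) :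
    ∀ k, k ≤ S.K → ∀ᵐ V ∂(fieldMeasure S.P k G), ((stdTowerInput X K 𝔖).towerWith slot).rhoRes (eps1Of S K) k V
      ≤ ((stdTowerInput X K 𝔖).towerWith slot).chi k V *
        Real.exp (-(((stdTowerInput X K 𝔖).towerWith slot).mainT k (Hist.triv S.P k) V)
          + (stdTowerInput X K 𝔖).Pint k (Hist.triv S.P k) V
          - ((stdTowerInput X K 𝔖).towerWith slot).Ecst k + ((stdTowerInput X K 𝔖).towerWith slot).Rm k)
  | 0, _ => restricted41_zero X K 𝔖 slot
  | k + 1, hk => restricted41_succ X K 𝔖 slot k hk (D k hk) (restricted41_ae D k (by omega))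

/-- **THE SPINE'S `Ineq47RestrictedAE` INHABITED for the constructed tower at the profile `ε₁`**, `k ≤ K`, modulo the trivial-history inputs:
`χ^{47}_k·χ^{ε₁(k)}·exp[F − E_k − Rm_k] ≤ ρ^res_k` dV-a.e. (from the χ-of-(4) form: `χ^{47}_k ≤ 1`, `χ^{ε₁(k)} = χ_k`). [cite: Balaban1985UV3, (47) p.267] -/
theorem ineq47RestrictedAE_std (D : ∀ j, j + 1 ≤ S.K → TrivStepInputs X K 𝔖 slot j) (k : ℕ) (hk : k ≤ S.K) :
    ((stdTowerInput X K 𝔖).towerWith slot).Ineq47RestrictedAE (eps1Of S K) k := by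
  filter_upwards [restricted47_chi_ae X K 𝔖 slot D k hk] with V hV
  have hnn : 0 ≤ chiAll k (eps1Of S K k) V *
      Real.exp (((stdTowerInput X K 𝔖).towerWith slot).explicitExpo k V - ((stdTowerInput X K 𝔖).towerWith slot).Ecst k
        - ((stdTowerInput X K 𝔖).towerWith slot).Rm k) :=
    mul_nonneg (SectB.TowerObjects.chiAll_nonneg k _ V) (Real.exp_pos _).le
  rw [mul_assoc]
  exact (mul_le_of_le_one_left hnn (((stdTowerInput X K 𝔖).towerWith slot).chi47_le_one k V)).trans hV

/-- **THE SPINE'S `Ineq41RestrictedAE` INHABITED for the constructed tower at the profile `ε₁`**, `k ≤ K`, modulo the trivial-history inputs: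
`ρ^res_k ≤ χ^{ε₁(k)}·exp[F − E_k + Rm_k]` dV-a.e. [cite: Balaban1985UV3, (41) p.266] -/
theorem ineq41RestrictedAE_std (D : ∀ j, j + 1 ≤ S.K → TrivStepInputs X K 𝔖 slot j) (k : ℕ) (hk : k ≤ S.K) :
    ((stdTowerInput X K 𝔖).towerWith slot).Ineq41RestrictedAE (eps1Of S K) k := by
  filter_upwards [restricted41_ae X K 𝔖 slot D k hk] with V hV
  exact hV

/-- **THE TWO-SIDED SANDWICH ON THE WHOLE `ε₁(k)`-SMALL DOMAIN, dV-a.e., WITH NO THRESHOLD-INCLUSION HYPOTHESIS** (contrast the spine's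
`sandwich_ae_of_inclusion`, which needs «δ_k-small field ⇒ (47)-small minimizer» = the cell's node N5thr / latent row G3D-09): for dV-a.e. `V`
with all plaquette variables `ε₁(k)`-small, `e^{−E_k − Rm_k}·e^{F(V)} ≤ ρ^res_k(V) ≤ e^{−E_k + Rm_k}·e^{F(V)}`, `F = explicitExpo` — the shape the
cell's K1-S node consumes (constant `e^{−E_k}`, log-radius `Rm_k`, sized by `SectBRemainder.Rm_le_height`).  The inclusion is not needed because
R3D-02 is booked with the field function of (4) (it carries G3D-09 in its label). [cite: Balaban1985UV3, (41) p.266 + (47) p.267] -/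
theorem sandwich_ae_std (D : ∀ j, j + 1 ≤ S.K → TrivStepInputs X K 𝔖 slot j) (k : ℕ) (hk : k ≤ S.K) :
    ∀ᵐ V ∂(fieldMeasure S.P k G), PlaqSmall (eps1Of S K k) V →
      Real.exp (-((stdTowerInput X K 𝔖).towerWith slot).Ecst k - ((stdTowerInput X K 𝔖).towerWith slot).Rm k) *
          Real.exp (((stdTowerInput X K 𝔖).towerWith slot).explicitExpo k V)
        ≤ ((stdTowerInput X K 𝔖).towerWith slot).rhoRes (eps1Of S K) k V ∧
      ((stdTowerInput X K 𝔖).towerWith slot).rhoRes (eps1Of S K) k V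
        ≤ Real.exp (-((stdTowerInput X K 𝔖).towerWith slot).Ecst k + ((stdTowerInput X K 𝔖).towerWith slot).Rm k) *
          Real.exp (((stdTowerInput X K 𝔖).towerWith slot).explicitExpo k V) := by
  filter_upwards [restricted47_chi_ae X K 𝔖 slot D k hk, restricted41_ae X K 𝔖 slot D k hk] with V hl hu hδ
  have h1 : ((stdTowerInput X K 𝔖).towerWith slot).chi k V = 1 := by
    rw [FibreClash.chi_eq X K 𝔖 slot k V, if_pos hδ]
  rw [h1, one_mul] at hl hu
  constructor
  · rw [← Real.exp_add]
    convert hl using 2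
    show _ = ((stdTowerInput X K 𝔖).towerWith slot).explicitExpo k V - _ - _
    ring
  · rw [← Real.exp_add]
    convert hu using 2
    show _ = ((stdTowerInput X K 𝔖).towerWith slot).explicitExpo k V - _ + _
    ring


end Std

end Summit.QuantumFields.Balaban3D.Proofs.RestrictedResidualsStd

end
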